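import Summits.QuantumFields.BalabanUV.Beta.FP.ExpLocalisedBubbleOrder2

/-!
# `BalabanUV.Beta.FP.ExpLocalisedBubbleOrder2Point` — road «FP», N7 H-route, row H2-ASM-1 (engine, part 2): THE ORDER-TWO SMEAR EXPANSION AT A POINT
# OF `ℤ⁴` (remainder `(‖z‖∞+1)^{−(a+3)}`, constant DISPLAYED as a named datum) and the named constants of orders zero and one
# ([folklore] lattice bookkeeping; nothing of the manuscripts)

HONEST DEPENDENCY (page 1, mandatory): continuum YM on T⁴ ⇐ BetaPertH ∧ nine spine estimates (0/9 proved); BetaPertH ⇐ (D1) ∧ (D4) ∧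
CAP+tail; G-an2-4 gates asym, D1 and NE2/3/4.  HONEST FRAMING (cell contract, verbatim): «discharging `BetaPertH` makes Bałaban's UV
stability UNCONDITIONAL — a real constructive-QFT result; it is NOT the continuum limit and NOT the Clay problem.»  THIS MODULE is elementary [folklore] real
analysis on `ℤ⁴`; the DATA definitions `Θ`, `K₀`, `K₁`, `K₂`, `Zm` are [our object] ABBREVIATIONS OF EXPLICIT REAL CONSTANTS (letters of the engine), nothing else;
no `Prop` is defined, nothing is cited, 0 sorry.  NOT the bubble of the perfect theory, NOT `hgerm`, NOT `hasym`, NOT D1, NOT BetaPertH, NOT continuum, NOT Clay.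

ROW: `H2V-DESIGN.md` f78878bd5f8d2d18 §4 H2-ASM-1 (owner d1-p3-g6; first refusal of this lineage, R-FP-23 (c)).  THIS FILE = part 2 of the engine; part 1 is
`FP/ExpLocalisedBubbleOrder2` (abstract base point), the double smear is `FP/ExpLocalisedBubbleMixed`.

CONTENT (`n := ‖z‖∞ = supNorm z`, `Δ_i := Δ_[Pi.single i 1]`).
* §1 named letters: `Θ δ m` (= the engine's two-point letter `2^{m+1}(m!e^{δ/2}(2/δ)^m)e^{δ/2}Zl 4 (δ/2)²`), `K₀ δ A₀ A₁ a`, `K₁ δ A₀ A₁ A₂ a` (the constants of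
  `ExpLocalisedBubblePoint.abs_smear_sub_order0/1_le_point`, restated BY NAME as `…_point'`), `K₂ δ A₀ A₁ A₂ A₃ a`, `Zm δ m` (one-point letter `m!e^{δ/2}(2/δ)^m·Zl 4 (δ/2)`).
* §2 **`abs_smear_sub_order2_le_point`**: `|c(x,y)| ≤ C·e^{−δ(|x|₁+|y|₁)}`, `|F t| ≤ A₀/(n_t+1)^a`, `|Δ_iF t| ≤ A₁/(n_t+1)^{a+1}`, `|Δ_iΔ_jF t| ≤ A₂/(n_t+1)^{a+2}`,
  `|Δ_iΔ_jΔ_lF t| ≤ A₃/(n_t+1)^{a+3}` ⟹ for EVERY `z`,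
  `|Σ' c·F(z+x−y) − (Σ'c)·F z − Σ_i m_i·(Δ_iF z − ½Δ_iΔ_iF z) − ½Σ_{i,j} M_{ij}·Δ_iΔ_jF z| ≤ C·K₂/(n+1)^{a+3}` (near radius `⌊n/4⌋`, far exponent `a+3`, core `n ≤ 3` crude).
NOT HERE: product∕marginal weights (`FP/ExpLocalisedBubbleMarginals`), the double smear (`FP/ExpLocalisedBubbleMixed`).
Unit `b2b-balaban-beta-d1-formalise-leaf-02` (gen 8).
-/

noncomputable section

namespace Summit.QuantumFields.BalabanUV.Beta.FP.ExpLocalisedBubbleOrder2Point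

open Finset Filter Topology fwdDiff
open scoped BigOperators
open Literature.MathematicalPhysics.QuantumFieldTheory.Balaban1983to89
open Literature.MathematicalPhysics.QuantumFieldTheory.Balaban1983to89.Beta
open B12Sec2to5 (l1 l1_nonneg abs_coord_le_l1)
open ExpKernelCalculus (Site Zl Zl_pos)
open Summit.QuantumFields.BalabanUV.Beta.FP.StencilMoments (summable_of_weight_exp)
open Summit.QuantumFields.BalabanUV.Beta.FP.HorizontalBookkeepingTail (hasSum_mul supNorm_le_add_of_box)
open Summit.QuantumFields.BalabanUV.Beta.FP.ExpLocalisedBubble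
open Summit.QuantumFields.BalabanUV.Beta.FP.ExpLocalisedBubblePoint
open Summit.QuantumFields.BalabanUV.Beta.FP.ExpLocalisedBubbleProduct
open Summit.QuantumFields.BalabanUV.Beta.FP.ExpLocalisedBubbleOrder2
open DyadicShell (Pt supNorm supNorm_eq_zero_iff)

/-! ## §1 Named letters and constants -/

/-- [our object] The two-point exponential letter of the engine on `ℤ⁴`: `Θ_m := 2^{m+1}·(m!·e^{δ/2}·(2/δ)^m)·e^{δ/2}·Zl 4 (δ/2)²`. -/
def Θ (δ : ℝ) (m : ℕ) : ℝ := 2 ^ (m + 1) * ((m.factorial : ℝ) * Real.exp (δ / 2) * (2 / δ) ^ m) * Real.exp (δ / 2) * Zl 4 (δ / 2) ^ 2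

/-- [our object] The one-point exponential letter on `ℤ⁴`: `Zm_m := (m!·e^{δ/2}·(2/δ)^m)·Zl 4 (δ/2)` (`Σ'_x (|x|₁+1)^m e^{−δ|x|₁} ≤ Zm_m`). -/
def Zm (δ : ℝ) (m : ℕ) : ℝ := ((m.factorial : ℝ) * Real.exp (δ / 2) * (2 / δ) ^ m) * Zl 4 (δ / 2)

/-- [our object] The constant of the ORDER-ZERO point expansion (`ExpLocalisedBubblePoint.abs_smear_sub_order0_le_point`). -/
def K₀ (δ A₀ A₁ : ℝ) (a : ℕ) : ℝ :=
  (5 / 4 : ℝ) ^ (a + 1) * (4 * A₁ * Θ δ 1 / (3 / 4 : ℝ) ^ (a + 1) + 2 * A₀ * Θ δ (a + 1) * 16 ^ (a + 1)) + (4 : ℝ) ^ (a + 1) * (2 * A₀ * Θ δ 0)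

/-- [our object] The constant of the ORDER-ONE point expansion (`ExpLocalisedBubblePoint.abs_smear_sub_order1_le_point`). -/
def K₁ (δ A₀ A₁ A₂ : ℝ) (a : ℕ) : ℝ :=
  (5 / 4 : ℝ) ^ (a + 2) * (20 * A₂ * Θ δ 2 / (3 / 4 : ℝ) ^ (a + 2) + (2 * A₀ * Θ δ (a + 2) + A₁ * Θ δ (a + 2 + 1)) * 16 ^ (a + 2))
    + (4 : ℝ) ^ (a + 2) * (2 * A₀ * Θ δ 0 + 4 * A₁ * Θ δ 1)

/-- [our object] The constant of the ORDER-TWO point expansion (§2). -/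
def K₂ (δ A₀ A₁ A₂ A₃ : ℝ) (a : ℕ) : ℝ :=
  (5 / 4 : ℝ) ^ (a + 3) * (100 * A₃ * Θ δ 3 / (3 / 4 : ℝ) ^ (a + 3) + (2 * A₀ * Θ δ (a + 3) + A₁ * Θ δ (a + 3 + 1) + A₂ * Θ δ (a + 3 + 2)) * 16 ^ (a + 3))
    + (4 : ℝ) ^ (a + 3) * (2 * A₀ * Θ δ 0 + (4 * A₁ + 2 * A₂) * Θ δ 1 + 8 * A₂ * Θ δ 2)

/-- [folklore] The letters are nonnegative for `δ > 0`. -/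
theorem Θ_nonneg {δ : ℝ} (hδ : 0 < δ) (m : ℕ) : 0 ≤ Θ δ m := by
  have := Zl_pos (D := 4) (half_pos hδ); unfold Θ; positivity

/-- [folklore] The one-point letters are nonnegative for `δ > 0`. -/
theorem Zm_nonneg {δ : ℝ} (hδ : 0 < δ) (m : ℕ) : 0 ≤ Zm δ m := by
  have := Zl_pos (D := 4) (half_pos hδ); unfold Zm; positivity

/-- [folklore] `K₂ ≥ 0` for nonnegative data. -/
theorem K₂_nonneg {δ A₀ A₁ A₂ A₃ : ℝ} (hδ : 0 < δ) (h0 : 0 ≤ A₀) (h1 : 0 ≤ A₁) (h2 : 0 ≤ A₂) (h3 : 0 ≤ A₃) (a : ℕ) : 0 ≤ K₂ δ A₀ A₁ A₂ A₃ a := by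
  have := fun m => Θ_nonneg hδ m
  have h03 := this 0; have h13 := this 1; have h23 := this 2; have h33 := this 3
  have ha3 := this (a + 3); have ha4 := this (a + 3 + 1); have ha5 := this (a + 3 + 2)
  unfold K₂; positivity

/-- [folklore] `K₁ ≥ 0` for nonnegative data. -/
theorem K₁_nonneg {δ A₀ A₁ A₂ : ℝ} (hδ : 0 < δ) (h0 : 0 ≤ A₀) (h1 : 0 ≤ A₁) (h2 : 0 ≤ A₂) (a : ℕ) : 0 ≤ K₁ δ A₀ A₁ A₂ a := by
  have := fun m => Θ_nonneg hδ m
  have h03 := this 0; have h13 := this 1; have h23 := this 2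
  have ha3 := this (a + 2); have ha4 := this (a + 2 + 1)
  unfold K₁; positivity

/-- [folklore] `K₀ ≥ 0` for nonnegative data. -/
theorem K₀_nonneg {δ A₀ A₁ : ℝ} (hδ : 0 < δ) (h0 : 0 ≤ A₀) (h1 : 0 ≤ A₁) (a : ℕ) : 0 ≤ K₀ δ A₀ A₁ a := by
  have := fun m => Θ_nonneg hδ m
  have h03 := this 0; have h13 := this 1; have ha3 := this (a + 1)
  unfold K₀; positivity

/-- [folklore] THE ONE-POINT LETTER BOUND BY NAME: `Σ'_x (|x|₁+1)^m e^{−δ|x|₁} ≤ Zm δ m` (and the family is summable). -/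
theorem tsum_expWeight_pow_le_Zm {δ : ℝ} (hδ : 0 < δ) (m : ℕ) :
    Summable (fun x : Pt => (l1 x + 1) ^ m * Real.exp (-δ * l1 x)) ∧ ∑' x : Pt, (l1 x + 1) ^ m * Real.exp (-δ * l1 x) ≤ Zm δ m :=
  summable_expWeight_pow (D := 4) hδ m

section Point

variable {c : Pt × Pt → ℝ} {F : Pt → ℝ} {C δ A₀ A₁ A₂ A₃ : ℝ} {a : ℕ}

/-- **ORDER ZERO AT A POINT, CONSTANT BY NAME** (`ExpLocalisedBubblePoint.abs_smear_sub_order0_le_point` restated with `K₀`). [folklore] -/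
theorem abs_smear_sub_order0_le_point' (hδ : 0 < δ)
    (hc : ∀ p : Pt × Pt, |c p| ≤ C * (Real.exp (-δ * l1 p.1) * Real.exp (-δ * l1 p.2)))
    (hF0 : ∀ t : Pt, |F t| ≤ A₀ / ((supNorm t : ℝ) + 1) ^ a)
    (hF1 : ∀ (t : Pt) (i : Fin 4), |Δ_[(Pi.single i 1 : Pt)] F t| ≤ A₁ / ((supNorm t : ℝ) + 1) ^ (a + 1)) (z : Pt) :
    |∑' p : Pt × Pt, c p * F (z + p.1 - p.2) - (∑' p : Pt × Pt, c p) * F z| ≤ C * K₀ δ A₀ A₁ a / ((supNorm z : ℝ) + 1) ^ (a + 1) :=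
  abs_smear_sub_order0_le_point hδ hc hF0 hF1 z

/-- **ORDER ONE AT A POINT, CONSTANT BY NAME** (`ExpLocalisedBubblePoint.abs_smear_sub_order1_le_point` restated with `K₁`). [folklore] -/
theorem abs_smear_sub_order1_le_point' (hδ : 0 < δ)
    (hc : ∀ p : Pt × Pt, |c p| ≤ C * (Real.exp (-δ * l1 p.1) * Real.exp (-δ * l1 p.2)))
    (hF0 : ∀ t : Pt, |F t| ≤ A₀ / ((supNorm t : ℝ) + 1) ^ a)
    (hF1 : ∀ (t : Pt) (i : Fin 4), |Δ_[(Pi.single i 1 : Pt)] F t| ≤ A₁ / ((supNorm t : ℝ) + 1) ^ (a + 1))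
    (hF2 : ∀ (t : Pt) (i j : Fin 4), |Δ_[(Pi.single i 1 : Pt)] (Δ_[(Pi.single j 1 : Pt)] F) t| ≤ A₂ / ((supNorm t : ℝ) + 1) ^ (a + 2))
    (z : Pt) :
    |∑' p : Pt × Pt, c p * F (z + p.1 - p.2) - (∑' p : Pt × Pt, c p) * F z
        - ∑ i, (∑' p : Pt × Pt, c p * ((p.1 - p.2) i : ℝ)) * Δ_[(Pi.single i 1 : Pt)] F z|
      ≤ C * K₁ δ A₀ A₁ A₂ a / ((supNorm z : ℝ) + 1) ^ (a + 2) :=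
  abs_smear_sub_order1_le_point hδ hc hF0 hF1 hF2 z

/-- **H2-a ENGINE, ORDER TWO, AT A POINT**: `|c(x,y)| ≤ C·e^{−δ(|x|₁+|y|₁)}`, `|F t| ≤ A₀/(‖t‖∞+1)^a`, `|Δ_iF t| ≤ A₁/(‖t‖∞+1)^{a+1}`,
`|Δ_iΔ_jF t| ≤ A₂/(‖t‖∞+1)^{a+2}`, `|Δ_iΔ_jΔ_lF t| ≤ A₃/(‖t‖∞+1)^{a+3}` ⟹ for EVERY `z ∈ ℤ⁴`, with `m_i := Σ' c p·(p.1−p.2)_i`, `M_{ij} := Σ' c p·(p.1−p.2)_i(p.1−p.2)_j`,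
`|Σ' c p·F(z+p.1−p.2) − (Σ'c)·F z − Σ_i m_i·(Δ_iF z − ½Δ_iΔ_iF z) − ½Σ_{i,j} M_{ij}·Δ_iΔ_jF z| ≤ C·K₂/(‖z‖∞+1)^{a+3}`. [folklore] -/
theorem abs_smear_sub_order2_le_point (hδ : 0 < δ)
    (hc : ∀ p : Pt × Pt, |c p| ≤ C * (Real.exp (-δ * l1 p.1) * Real.exp (-δ * l1 p.2)))
    (hF0 : ∀ t : Pt, |F t| ≤ A₀ / ((supNorm t : ℝ) + 1) ^ a)
    (hF1 : ∀ (t : Pt) (i : Fin 4), |Δ_[(Pi.single i 1 : Pt)] F t| ≤ A₁ / ((supNorm t : ℝ) + 1) ^ (a + 1))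
    (hF2 : ∀ (t : Pt) (i j : Fin 4), |Δ_[(Pi.single i 1 : Pt)] (Δ_[(Pi.single j 1 : Pt)] F) t| ≤ A₂ / ((supNorm t : ℝ) + 1) ^ (a + 2))
    (hF3 : ∀ (t : Pt) (i j l : Fin 4), |Δ_[(Pi.single i 1 : Pt)] (Δ_[(Pi.single j 1 : Pt)] (Δ_[(Pi.single l 1 : Pt)] F)) t|
      ≤ A₃ / ((supNorm t : ℝ) + 1) ^ (a + 3))
    (z : Pt) :
    |∑' p : Pt × Pt, c p * F (z + p.1 - p.2) - (∑' p : Pt × Pt, c p) * F z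
        - ∑ i, (∑' p : Pt × Pt, c p * ((p.1 - p.2) i : ℝ))
            * (Δ_[(Pi.single i 1 : Pt)] F z - (1 / 2) * Δ_[(Pi.single i 1 : Pt)] (Δ_[(Pi.single i 1 : Pt)] F) z)
        - (1 / 2) * ∑ i, ∑ j, (∑' p : Pt × Pt, c p * ((((p.1 - p.2) i : ℤ) : ℝ) * (((p.1 - p.2) j : ℤ) : ℝ)))
            * Δ_[(Pi.single i 1 : Pt)] (Δ_[(Pi.single j 1 : Pt)] F) z|
      ≤ C * K₂ δ A₀ A₁ A₂ A₃ a / ((supNorm z : ℝ) + 1) ^ (a + 3) := by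
  have hC := nonneg_of_loc hc
  have hA0 := nonneg_of_decay_pow hF0
  have hA1 : 0 ≤ A₁ := nonneg_of_decay_pow (fun t => hF1 t 0)
  have hA2 : 0 ≤ A₂ := nonneg_of_decay_pow (fun t => hF2 t 0 0)
  have hA3 : 0 ≤ A₃ := nonneg_of_decay_pow (fun t => hF3 t 0 0 0)
  have hΘ := fun m => Θ_nonneg hδ m
  have hΘ0 := hΘ 0; have hΘ1 := hΘ 1; have hΘ2 := hΘ 2; have hΘ3 := hΘ 3
  have hΘk := hΘ (a + 3); have hΘk1 := hΘ (a + 3 + 1); have hΘk2 := hΘ (a + 3 + 2)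
  set Kout : ℝ := 100 * A₃ * Θ δ 3 / (3 / 4 : ℝ) ^ (a + 3) + (2 * A₀ * Θ δ (a + 3) + A₁ * Θ δ (a + 3 + 1) + A₂ * Θ δ (a + 3 + 2)) * 16 ^ (a + 3)
    with hKout
  set Kcore : ℝ := 2 * A₀ * Θ δ 0 + (4 * A₁ + 2 * A₂) * Θ δ 1 + 8 * A₂ * Θ δ 2 with hKcore
  have hKout0 : 0 ≤ Kout := by positivity
  have hKcore0 : 0 ≤ Kcore := by positivity
  set n : ℝ := (supNorm z : ℝ) with hn
  have hn0 : 0 ≤ n := by positivity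
  -- global bounds
  have hFA : ∀ t, |F t| ≤ A₀ := fun t => (hF0 t).trans (div_le_self hA0 (one_le_pow₀ (by
    have := (Nat.cast_nonneg (supNorm t) : (0:ℝ) ≤ _); linarith)))
  have hF1z : ∀ i, |Δ_[(Pi.single i 1 : Pt)] F z| ≤ A₁ := fun i => (hF1 z i).trans (div_le_self hA1 (one_le_pow₀ (by linarith)))
  have hF2z : ∀ i j, |Δ_[(Pi.single i 1 : Pt)] (Δ_[(Pi.single j 1 : Pt)] F) z| ≤ A₂ :=
    fun i j => (hF2 z i j).trans (div_le_self hA2 (one_le_pow₀ (by linarith)))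
  show _ ≤ C * ((5 / 4 : ℝ) ^ (a + 3) * Kout + (4 : ℝ) ^ (a + 3) * Kcore) / (n + 1) ^ (a + 3)
  by_cases hz : 4 ≤ supNorm z
  · -- OUTER
    obtain ⟨hρ1, hρ4, hρ16⟩ := quarter_bounds hz
    set ρ : ℕ := supNorm z / 4 with hρ
    have hn4 : (4 : ℝ) ≤ n := by rw [hn]; exact_mod_cast hz
    have hρpos : (0 : ℝ) < ρ := by exact_mod_cast hρ1
    have h16 : n ≤ 16 * (ρ : ℝ) := by rw [hn]; exact_mod_cast hρ16
    set B : ℝ := A₃ / ((3 / 4 : ℝ) * n) ^ (a + 3) with hB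
    have hB0 : 0 ≤ B := by positivity
    have hF3box : ∀ t : Pt, (∀ i, |t i - z i| ≤ (ρ : ℤ)) →
        ∀ i j l, |Δ_[(Pi.single i 1 : Pt)] (Δ_[(Pi.single j 1 : Pt)] (Δ_[(Pi.single l 1 : Pt)] F)) t| ≤ B := by
      intro t ht i j l
      have hgeo := box_geometry_one hz ht
      refine (hF3 t i j l).trans ?_
      have key : ((3 / 4 : ℝ) * n) ^ (a + 3) ≤ ((supNorm t : ℝ) + 1) ^ (a + 3) := pow_le_pow_left₀ (by positivity) hgeo _
      exact div_le_div_of_nonneg_left hA3 (by positivity) key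
    have hmain := abs_smear_sub_order2_le (D := 4) hδ hc hFA hρ1 hB0 hA1 hA2 (a + 3) hF1z hF2z hF3box
    refine hmain.trans ?_
    have hρinv : 1 / (ρ : ℝ) ^ (a + 3) ≤ (16 : ℝ) ^ (a + 3) / n ^ (a + 3) := by
      rw [div_le_div_iff₀ (by positivity) (by positivity), one_mul, ← mul_pow]
      exact pow_le_pow_left₀ hn0 h16 _
    have hn_ne : n ≠ 0 := by linarith
    have h34 : ((3 : ℝ) / 4) ^ (a + 3) ≠ 0 := by positivity
    have step1 : C * (((4 : ℕ) : ℝ) * (((4 : ℕ) : ℝ) + 1) ^ 2 * B * Θ δ 3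
          + (2 * A₀ * Θ δ (a + 3) + A₁ * Θ δ (a + 3 + 1) + A₂ * Θ δ (a + 3 + 2)) / (ρ : ℝ) ^ (a + 3))
        ≤ C * (Kout / n ^ (a + 3)) := by
      refine mul_le_mul_of_nonneg_left ?_ hC
      have t1 : ((4 : ℕ) : ℝ) * (((4 : ℕ) : ℝ) + 1) ^ 2 * B * Θ δ 3 = (100 * A₃ * Θ δ 3 / (3 / 4 : ℝ) ^ (a + 3)) / n ^ (a + 3) := by
        rw [hB, mul_pow]; push_cast; field_simp; ring
      have t2 : (2 * A₀ * Θ δ (a + 3) + A₁ * Θ δ (a + 3 + 1) + A₂ * Θ δ (a + 3 + 2)) / (ρ : ℝ) ^ (a + 3)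
          ≤ (2 * A₀ * Θ δ (a + 3) + A₁ * Θ δ (a + 3 + 1) + A₂ * Θ δ (a + 3 + 2)) * 16 ^ (a + 3) / n ^ (a + 3) := by
        have hnum : 0 ≤ 2 * A₀ * Θ δ (a + 3) + A₁ * Θ δ (a + 3 + 1) + A₂ * Θ δ (a + 3 + 2) := by positivity
        calc _ = (2 * A₀ * Θ δ (a + 3) + A₁ * Θ δ (a + 3 + 1) + A₂ * Θ δ (a + 3 + 2)) * (1 / (ρ : ℝ) ^ (a + 3)) := by ring
          _ ≤ (2 * A₀ * Θ δ (a + 3) + A₁ * Θ δ (a + 3 + 1) + A₂ * Θ δ (a + 3 + 2)) * ((16 : ℝ) ^ (a + 3) / n ^ (a + 3)) :=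
              mul_le_mul_of_nonneg_left hρinv hnum
          _ = _ := by ring
      have eK : Kout / n ^ (a + 3) = (100 * A₃ * Θ δ 3 / (3 / 4 : ℝ) ^ (a + 3)) / n ^ (a + 3)
          + (2 * A₀ * Θ δ (a + 3) + A₁ * Θ δ (a + 3 + 1) + A₂ * Θ δ (a + 3 + 2)) * 16 ^ (a + 3) / n ^ (a + 3) := by
        rw [hKout, add_div]
      rw [eK]
      have e0 : ((4 : ℕ) : ℝ) * (((4 : ℕ) : ℝ) + 1) ^ 2 * B * Θ δ 3
          + (2 * A₀ * Θ δ (a + 3) + A₁ * Θ δ (a + 3 + 1) + A₂ * Θ δ (a + 3 + 2)) / (ρ : ℝ) ^ (a + 3)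
          = (100 * A₃ * Θ δ 3 / (3 / 4 : ℝ) ^ (a + 3)) / n ^ (a + 3)
            + (2 * A₀ * Θ δ (a + 3) + A₁ * Θ δ (a + 3 + 1) + A₂ * Θ δ (a + 3 + 2)) / (ρ : ℝ) ^ (a + 3) := by rw [t1]
      rw [e0]
      linarith
    refine (le_of_eq ?_).trans (step1.trans ?_)
    · rfl
    have h54 : Kout / n ^ (a + 3) ≤ (5 / 4 : ℝ) ^ (a + 3) * Kout / (n + 1) ^ (a + 3) := by
      rw [div_le_div_iff₀ (by positivity) (by positivity)]
      have key : (n + 1) ^ (a + 3) ≤ ((5 / 4 : ℝ) * n) ^ (a + 3) := pow_le_pow_left₀ (by positivity) (by linarith) _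
      calc Kout * (n + 1) ^ (a + 3) ≤ Kout * ((5 / 4 : ℝ) * n) ^ (a + 3) := mul_le_mul_of_nonneg_left key hKout0
        _ = (5 / 4 : ℝ) ^ (a + 3) * Kout * n ^ (a + 3) := by rw [mul_pow]; ring
    have h55 : (5 / 4 : ℝ) ^ (a + 3) * Kout / (n + 1) ^ (a + 3) ≤ ((5 / 4 : ℝ) ^ (a + 3) * Kout + (4 : ℝ) ^ (a + 3) * Kcore) / (n + 1) ^ (a + 3) :=
      div_le_div_of_nonneg_right (le_add_of_nonneg_right (by positivity)) (by positivity)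
    calc C * (Kout / n ^ (a + 3)) ≤ C * ((5 / 4 : ℝ) ^ (a + 3) * Kout / (n + 1) ^ (a + 3)) := mul_le_mul_of_nonneg_left h54 hC
      _ ≤ C * (((5 / 4 : ℝ) ^ (a + 3) * Kout + (4 : ℝ) ^ (a + 3) * Kcore) / (n + 1) ^ (a + 3)) := mul_le_mul_of_nonneg_left h55 hC
      _ = _ := by ring
  · -- CORE: crude bounds
    have hz3 : supNorm z ≤ 3 := by omega
    have hn3 : n ≤ 3 := by simp only [hn]; exact_mod_cast hz3
    have hw := summable_weight hδ hc
    have h0 := summable_loc_mul_pow hδ hc 0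
    simp only [pow_zero, mul_one] at h0
    have eΘ : ∀ m : ℕ, (2 : ℝ) ^ (m + 1) * ((m.factorial : ℝ) * Real.exp (δ / 2) * (2 / δ) ^ m) * Real.exp (δ / 2) * Zl 4 (δ / 2) ^ 2 = Θ δ m :=
      fun m => rfl
    have h0b : ∑' p : Pt × Pt, |c p| ≤ C * Θ δ 0 := by
      have h := tsum_loc_mul_pow_le hδ hc 0
      rw [eΘ 0] at h
      calc ∑' p : Pt × Pt, |c p| = ∑' p : Pt × Pt, |c p| * ((l1 p.1 + 1) + (l1 p.2 + 1)) ^ 0 := by simp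
        _ ≤ _ := h
    have h1b : ∑' p : Pt × Pt, |c p| * ((l1 p.1 + 1) + (l1 p.2 + 1)) ^ 1 ≤ C * Θ δ 1 := by
      have h := tsum_loc_mul_pow_le hδ hc 1; rwa [eΘ 1] at h
    have h2b : ∑' p : Pt × Pt, |c p| * ((l1 p.1 + 1) + (l1 p.2 + 1)) ^ 2 ≤ C * Θ δ 2 := by
      have h := tsum_loc_mul_pow_le hδ hc 2; rwa [eΘ 2] at h
    have e1 : |∑' p : Pt × Pt, c p * F (z + p.1 - p.2)| ≤ C * Θ δ 0 * A₀ := by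
      have h := tsum_of_norm_bounded (h0.mul_right A₀).hasSum (f := fun p : Pt × Pt => c p * F (z + p.1 - p.2)) (fun p => by
        rw [Real.norm_eq_abs, abs_mul]; exact mul_le_mul_of_nonneg_left (hFA _) (abs_nonneg _))
      rw [Real.norm_eq_abs, tsum_mul_right] at h
      exact h.trans (mul_le_mul_of_nonneg_right h0b hA0)
    have e2 : |(∑' p : Pt × Pt, c p) * F z| ≤ C * Θ δ 0 * A₀ := by
      rw [abs_mul]
      have h := norm_tsum_le_tsum_norm hw.norm
      simp only [Real.norm_eq_abs] at h
      exact mul_le_mul (h.trans h0b) (hFA z) (abs_nonneg _) (by positivity)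
    have hmi : ∀ i, |∑' p : Pt × Pt, c p * ((p.1 - p.2) i : ℝ)| ≤ C * Θ δ 1 := by
      intro i
      have h := norm_tsum_le_tsum_norm (summable_firstMoment hδ hc i).norm
      simp only [Real.norm_eq_abs] at h
      refine h.trans ((Summable.tsum_le_tsum (fun p => ?_) (summable_firstMoment hδ hc i).abs (summable_loc_mul_pow hδ hc 1)).trans h1b)
      rw [abs_mul, pow_one]
      exact mul_le_mul_of_nonneg_left ((abs_coord_le_l1 (p.1 - p.2) i).trans (l1_sub_le_letters p.1 p.2)) (abs_nonneg _)
    have hMij : ∀ i j, |∑' p : Pt × Pt, c p * ((((p.1 - p.2) i : ℤ) : ℝ) * (((p.1 - p.2) j : ℤ) : ℝ))| ≤ C * Θ δ 2 := by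
      intro i j
      have h := norm_tsum_le_tsum_norm (summable_secondMoment hδ hc i j).norm
      simp only [Real.norm_eq_abs] at h
      refine h.trans ((Summable.tsum_le_tsum (fun p => ?_) (summable_secondMoment hδ hc i j).abs (summable_loc_mul_pow hδ hc 2)).trans h2b)
      rw [abs_mul]
      exact mul_le_mul_of_nonneg_left (abs_coord_mul_coord_le p.1 p.2 i j) (abs_nonneg _)
    have e3 : |∑ i, (∑' p : Pt × Pt, c p * ((p.1 - p.2) i : ℝ))
        * (Δ_[(Pi.single i 1 : Pt)] F z - (1 / 2) * Δ_[(Pi.single i 1 : Pt)] (Δ_[(Pi.single i 1 : Pt)] F) z)| ≤ 4 * (C * Θ δ 1 * (A₁ + A₂ / 2)) := by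
      refine (Finset.abs_sum_le_sum_abs _ _).trans ?_
      have hi : ∀ i ∈ (Finset.univ : Finset (Fin 4)), |(∑' p : Pt × Pt, c p * ((p.1 - p.2) i : ℝ))
          * (Δ_[(Pi.single i 1 : Pt)] F z - (1 / 2) * Δ_[(Pi.single i 1 : Pt)] (Δ_[(Pi.single i 1 : Pt)] F) z)| ≤ C * Θ δ 1 * (A₁ + A₂ / 2) := by
        intro i _
        rw [abs_mul]
        have hd : |Δ_[(Pi.single i 1 : Pt)] F z - (1 / 2) * Δ_[(Pi.single i 1 : Pt)] (Δ_[(Pi.single i 1 : Pt)] F) z| ≤ A₁ + A₂ / 2 := by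
          refine (abs_sub _ _).trans (add_le_add (hF1z i) ?_)
          rw [abs_mul, abs_of_pos (by norm_num : (0:ℝ) < 1 / 2)]
          have := hF2z i i; linarith
        exact mul_le_mul (hmi i) hd (abs_nonneg _) (by positivity)
      calc _ ≤ ∑ _i : Fin 4, C * Θ δ 1 * (A₁ + A₂ / 2) := Finset.sum_le_sum hi
        _ = 4 * (C * Θ δ 1 * (A₁ + A₂ / 2)) := by rw [Finset.sum_const, Finset.card_univ, Fintype.card_fin, nsmul_eq_mul]; norm_num
    have e4 : |(1 / 2) * ∑ i, ∑ j, (∑' p : Pt × Pt, c p * ((((p.1 - p.2) i : ℤ) : ℝ) * (((p.1 - p.2) j : ℤ) : ℝ)))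
        * Δ_[(Pi.single i 1 : Pt)] (Δ_[(Pi.single j 1 : Pt)] F) z| ≤ (1 / 2) * (4 * (4 * (C * Θ δ 2 * A₂))) := by
      rw [abs_mul, abs_of_pos (by norm_num : (0:ℝ) < 1 / 2)]
      refine mul_le_mul_of_nonneg_left ?_ (by norm_num)
      refine (Finset.abs_sum_le_sum_abs _ _).trans ?_
      have hi : ∀ i ∈ (Finset.univ : Finset (Fin 4)), |∑ j, (∑' p : Pt × Pt, c p * ((((p.1 - p.2) i : ℤ) : ℝ) * (((p.1 - p.2) j : ℤ) : ℝ)))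
          * Δ_[(Pi.single i 1 : Pt)] (Δ_[(Pi.single j 1 : Pt)] F) z| ≤ 4 * (C * Θ δ 2 * A₂) := by
        intro i _
        refine (Finset.abs_sum_le_sum_abs _ _).trans ?_
        have hj : ∀ j ∈ (Finset.univ : Finset (Fin 4)), |(∑' p : Pt × Pt, c p * ((((p.1 - p.2) i : ℤ) : ℝ) * (((p.1 - p.2) j : ℤ) : ℝ)))
            * Δ_[(Pi.single i 1 : Pt)] (Δ_[(Pi.single j 1 : Pt)] F) z| ≤ C * Θ δ 2 * A₂ := by
          intro j _
          rw [abs_mul]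
          exact mul_le_mul (hMij i j) (hF2z i j) (abs_nonneg _) (by positivity)
        calc _ ≤ ∑ _j : Fin 4, C * Θ δ 2 * A₂ := Finset.sum_le_sum hj
          _ = 4 * (C * Θ δ 2 * A₂) := by rw [Finset.sum_const, Finset.card_univ, Fintype.card_fin, nsmul_eq_mul]; norm_num
      calc _ ≤ ∑ _i : Fin 4, 4 * (C * Θ δ 2 * A₂) := Finset.sum_le_sum hi
        _ = 4 * (4 * (C * Θ δ 2 * A₂)) := by rw [Finset.sum_const, Finset.card_univ, Fintype.card_fin, nsmul_eq_mul]; norm_num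
    have etot : |∑' p : Pt × Pt, c p * F (z + p.1 - p.2) - (∑' p : Pt × Pt, c p) * F z
        - ∑ i, (∑' p : Pt × Pt, c p * ((p.1 - p.2) i : ℝ))
            * (Δ_[(Pi.single i 1 : Pt)] F z - (1 / 2) * Δ_[(Pi.single i 1 : Pt)] (Δ_[(Pi.single i 1 : Pt)] F) z)
        - (1 / 2) * ∑ i, ∑ j, (∑' p : Pt × Pt, c p * ((((p.1 - p.2) i : ℤ) : ℝ) * (((p.1 - p.2) j : ℤ) : ℝ)))
            * Δ_[(Pi.single i 1 : Pt)] (Δ_[(Pi.single j 1 : Pt)] F) z| ≤ C * Kcore := by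
      refine (abs_sub _ _).trans ((add_le_add ((abs_sub _ _).trans (add_le_add ((abs_sub _ _).trans (add_le_add e1 e2)) e3)) e4).trans
        (le_of_eq ?_))
      rw [hKcore]; ring
    refine etot.trans ?_
    rw [le_div_iff₀ (by positivity)]
    have key : (n + 1) ^ (a + 3) ≤ (4 : ℝ) ^ (a + 3) := pow_le_pow_left₀ (by positivity) (by linarith) _
    have : 0 ≤ (5 / 4 : ℝ) ^ (a + 3) * Kout := by positivity
    calc C * Kcore * (n + 1) ^ (a + 3) ≤ C * Kcore * (4 : ℝ) ^ (a + 3) := mul_le_mul_of_nonneg_left key (by positivity)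
      _ = C * ((4 : ℝ) ^ (a + 3) * Kcore) := by ring
      _ ≤ C * ((5 / 4 : ℝ) ^ (a + 3) * Kout + (4 : ℝ) ^ (a + 3) * Kcore) :=
          mul_le_mul_of_nonneg_left (le_add_of_nonneg_left this) hC

end Point

end Summit.QuantumFields.BalabanUV.Beta.FP.ExpLocalisedBubbleOrder2Point

end
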